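/-
Copyright (c) 2026 the pub-hodgecm-mathlib formalisation cell (harness21).  Prover seat hodgecm-mathlib-F0P3-p01 (g31), «(D-RAM) FOUR-FRAME» road of crux H413, line LH4, MS ROAD A,
STAGE B: sub-lemma F1 of the B56-ASSEMBLY `stub_B56_G1` (LH4-p08 (g2), ping 2026-09-04T00:24:21Z) — «THE STRATUM `(2ρ, 2ρ+s, 2ρ+s)` IS THE GLUED HNF FRAME SET».  2026-09-04.
-/
import Summits.HodgeConjecture.HodgeConjecture.Theorems.F0P3cDyRamDiagonalStrataShapes   -- ★ (LH4-p04 (g2)) B3: `dualisable_strata`, `hasAxis_latt_hnf_*`; brings ★ `hasAxis_unique`, ★ StrataDefs, ★ HNF ∕ HNFExists ∕ B2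
import HarnessLib

/-!
# Crux `H413`, MS ROAD A, STAGE B, B56-assembly sub-lemma F1: the stratum of axis vector `(2ρ, 2ρ+s, 2ρ+s)` is the set of GLUED HNF lattices

Cell `hodgecm-mathlib` (D-0151), FLOOR 0, crux item H413 = `stmt-HodgeConjecture-24833`; lane `--supports stmt-HodgeConjecture-24833 --as helper` (count-neutral).  THEOREMS ONLY
(no `def`, no instance, no notation, no `sorry`).  Dealt by the B56 assembler LH4-p08 (g2) (bus 2026-09-04T00:24:21Z) with the EXACT heads below; pure shape bookkeeping
(no `T`-diagonality, no dualisability criterion inside).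

THE MATHEMATICS (LH4-p10 (g2) MEMO v2 §3, B10 skeleton c61f53438acbd4dd).  `stratum σ ϖ T a` (★ `F0P3cDyRamDiagonalStrataDefs`) is the set of normalised `T`-stable lattices
that are dualisable and have axis vector `a` (`M ∩ Keᵢ = 𝔭^{aᵢ}eᵢ`).  For `a = (2ρ, 2ρ+s, 2ρ+s)` with `ρ, s ≥ 1`:  (⊆) write `M ∈ 𝓛₀(T)` in Hermite normal form
`(1 0 0; x ϖ^b 0; y z ϖ^c)·𝒪³` (★ `exists_latt_eq_latt_hnf`); ★ B3 `dualisable_strata` (LH4-p04 (g2)) puts `(b, c, x, y, z)` in one of the eight strata, whose axis vectors (★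
`hasAxis_latt_hnf_core∕T₃∕T₂∕T₁∕G1∕G2∕G3∕H`) are compared with `a` by ★ `hasAxis_unique`: only `G₁(ρ, s)` survives (`2ρ ≠ 0`, `s ≠ 0`), giving `b = ρ`, `c = 2ρ+s`, `|x| = |y| = 1`,
`|z| = |ϖ|^ρ`, `|yϖ^ρ − xz| = |ϖ|^{ρ+s}`, `s ≥ 2` EVEN; the glued letters are `ζ := z∕ϖ^ρ` (a unit) and `y″ := y − xζ` (`|y″| = |yϖ^ρ − xz|∕|ϖ^ρ| = |ϖ|^s`), so that
`(y, z) = (xζ + y″, ϖ^ρζ)` literally.  (⊇) a glued frame `(1 0 0; x ϖ^ρ 0; xζ+y″ ϖ^ρζ ϖ^{2ρ+s})` with `|x| = |ζ| = 1`, `|y″| = |ϖ|^s` (`s ≥ 1`) is a `GL₃` lattice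
(`det = ϖ^{3ρ+s}`), normalised (`|x| = 1`, `|xζ + y″| = 1`, ★ `normalised_latt_hnf_iff`), and has axis vector `(2ρ, 2ρ+s, 2ρ+s)` (★ `hasAxis_latt_hnf_G1`:
`(xζ+y″)ϖ^ρ − x·ϖ^ρζ = y″ϖ^ρ`).
* `exists_glued_of_mem_stratum_G1` — (⊆) with all the HNF letters and `2 ∣ s`, `2 ≤ s`.
* **`stratum_G1_eq`** — the set identity (LH4-p08 (g2)'s head (1), letters verbatim).
* **`two_dvd_of_mem_stratum_G1`** — a member forces `s` even (head (2); with (1): the stratum is EMPTY for odd `s`).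
HONEST LABEL.  Count-neutral (`--supports`); the census laws (MS) stay PROVER TARGETS until the B10 assembly lands; `HC_CM` is proved only modulo the 7 printed citations
(2 remaining named inputs: hLiu418 = `stmt-HodgeConjecture-24832`, h413 = `stmt-HodgeConjecture-24833`) until rung 0 closes.

## References
* [Kottwitz1986BaseChangeUnits] R. E. Kottwitz, *Base change for unit elements of Hecke algebras*, Compositio Math. 60 (1986), §1 pp. 240–241 (fixed-lattice counting by position).
* [Serre1980Trees] J.-P. Serre, *Trees*, Springer (1980), Ch. II §1.1 (lattices `g·𝒪^N`, Hermite normal forms, coordinate axes).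
-/

set_option autoImplicit false

noncomputable section

namespace Summit.HodgeConjecture.HodgeConjecture.Cruxes.H413.F0P3cDyRamDiagonalGluedStratum

open Matrix
open Literature.NumberTheory.Automorphic Literature.NumberTheory.Automorphic.HermitianLattice
open Literature.NumberTheory.Automorphic.UnitaryLatticeTree
open Summit.HodgeConjecture.HodgeConjecture.Cruxes.H413.F0P3cDyRamDiagonalTorusDefs
open Summit.HodgeConjecture.HodgeConjecture.Cruxes.H413.F0P3cDyRamDiagonalStrataDefs
open Summit.HodgeConjecture.HodgeConjecture.Cruxes.H413.F0P3cDyRamDiagonalStableLatticeHNF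
open Summit.HodgeConjecture.HodgeConjecture.Cruxes.H413.F0P3cDyRamDiagonalStableLatticeHNFExists
open Summit.HodgeConjecture.HodgeConjecture.Cruxes.H413.F0P3cDyRamDiagonalDualisableStrata
open Summit.HodgeConjecture.HodgeConjecture.Cruxes.H413.F0P3cDyRamDiagonalStrataAxis
open Summit.HodgeConjecture.HodgeConjecture.Cruxes.H413.F0P3cDyRamDiagonalStrataShapes
open scoped Valued WithZero Matrix MatrixGroups

variable {K : Type*} [Field K] [Valued K ℤᵐ⁰]

/-- **(⊆) A MEMBER OF THE STRATUM `(2ρ, 2ρ+s, 2ρ+s)` IS A GLUED HNF LATTICE `G₁(ρ, s)`**: `M = (1 0 0; x ϖ^ρ 0; y z ϖ^{2ρ+s})·𝒪³` with `|x| = |y| = 1`, `|z| = |ϖ^ρ|`,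
`|yϖ^ρ − xz| = |ϖ^{ρ+s}|`, and `s ≥ 2` is EVEN (★ HNF + ★ B3 `dualisable_strata` + ★ axis vectors + ★ `hasAxis_unique`; `ρ, s ≥ 1` rule out the seven other strata).
[cite: Kottwitz1986BaseChangeUnits, §1 pp. 240–241] [cite: Serre1980Trees, Ch. II §1.1] -/
theorem exists_hnf_of_mem_stratum_G1 {σ : K →+* K} (hvσ : ∀ a, Valued.v (σ a) = Valued.v a)
    (hfix : ∀ x : K, σ x = x → x ≠ 0 → ∃ n : ℤ, Valued.v x = WithZero.exp (2 * n)) {ϖ : K} (hϖ : Valued.v ϖ = WithZero.exp (-1 : ℤ))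
    (T : GL (Fin 3) K) {ρ s : ℕ} (hρ : 1 ≤ ρ) (hs : 1 ≤ s) {M : Submodule 𝒪[K] (Fin 3 → K)} (hM : M ∈ stratum σ ϖ T ![2 * ρ, 2 * ρ + s, 2 * ρ + s]) :
    ∃ x y z : K, Valued.v x = 1 ∧ Valued.v y = 1 ∧ Valued.v z = Valued.v (ϖ ^ ρ) ∧ Valued.v (y * ϖ ^ ρ - x * z) = Valued.v (ϖ ^ (ρ + s)) ∧ 2 ∣ s ∧ 2 ≤ s ∧
      M = latt (Matrix.of ![![1, 0, 0], ![x, ϖ ^ ρ, 0], ![y, z, ϖ ^ (2 * ρ + s)]]) ∧ mapGL T M = M ∧ IsDualisableLattice σ ϖ M := by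
  obtain ⟨hM0, hdual, ha⟩ := (mem_stratum_iff σ ϖ T _ M).1 hM
  obtain ⟨⟨g, rfl⟩, hT, hnorm⟩ := hM0
  have hq1 : ∀ n : ℕ, Valued.v (ϖ ^ n) ≤ 1 := fun n => by
    rw [map_pow]; exact pow_le_one₀ zero_le (by rw [hϖ, ← WithZero.exp_zero, WithZero.exp_le_exp]; omega)
  have hq_eq_one : ∀ n : ℕ, Valued.v (ϖ ^ n) = 1 → n = 0 := fun n h => by
    rw [map_pow, hϖ, ← WithZero.exp_nsmul, ← WithZero.exp_zero, WithZero.exp_inj] at h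
    simp at h
    omega
  -- the HNF model
  have hle : latt (g : Matrix (Fin 3) (Fin 3) K) ≤ stdLattice K 3 := fun w hw => mem_stdLattice.2 fun i => (hnorm i).1 w hw
  obtain ⟨b, c, x, y, z, hx, hy, hz, hV⟩ := exists_latt_eq_latt_hnf hϖ g hle (hnorm 0).2
  rw [hV] at hnorm hdual ha hT ⊢
  have hN := (normalised_latt_hnf_iff hx hy hz (hq1 b) (hq1 c)).1 hnorm
  have hxb : 1 ≤ b → Valued.v x = 1 := fun hb => hN.1.resolve_left fun h => by have := hq_eq_one b h; omega
  -- reading the axis vector of a candidate shape against `(2ρ, 2ρ+s, 2ρ+s)`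
  have hax : ∀ {a' : Fin 3 → ℕ}, HasAxis ϖ (latt (Matrix.of ![![1, 0, 0], ![x, ϖ ^ b, 0], ![y, z, ϖ ^ c]])) a' →
      a' 0 = 2 * ρ ∧ a' 1 = 2 * ρ + s ∧ a' 2 = 2 * ρ + s := fun ha' => by
    have h := hasAxis_unique hϖ ha' ha
    rw [h]
    simp
  -- the table
  rcases dualisable_strata hvσ hfix hϖ b c hx hy hz hnorm hdual with
    ⟨hb, hc⟩ | ⟨s', hc, hb, -, hs2⟩ | ⟨s', hb, hc, -, hs2, hzs, hy1⟩ | ⟨s', hb, hc, -, -, hz1, hw⟩ |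
    ⟨ρ', s', hρ', hs2, h2s, hb, hc, hzρ, hy1, hw⟩ | ⟨ρ', s', hρ', hs2, h2s, hb, hc, hzρ, hy1⟩ | ⟨ρ', s', hρ', hs2, h2s, hc, hb, hzρ, hy1⟩ | ⟨ρ', hρ', hb, hc, hzρ, hy1, hw⟩
  · exfalso; subst b; subst c
    have h := (hax (hasAxis_latt_hnf_core hϖ hx hy hz)).1
    simp at h; omega
  · exfalso; subst b; subst c
    have h := (hax (hasAxis_latt_hnf_T3 hϖ s' (hxb (by omega)) hy hz)).2.2
    simp at h; omega
  · exfalso; subst b; subst c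
    have h := (hax (hasAxis_latt_hnf_T2 hϖ (by omega) hx hzs hy1)).2.1
    simp at h; omega
  · exfalso; subst b; subst c
    have h := (hax (hasAxis_latt_hnf_T1 hϖ s' hx hz1 hw)).1
    simp at h; omega
  · -- THE glued stratum: `ρ' = ρ`, `s' = s`
    subst b; subst c
    obtain ⟨h0, h1, -⟩ := hax (hasAxis_latt_hnf_G1 hϖ ρ' s' (hxb hρ') hzρ hw)
    simp at h0 h1
    have hρρ : ρ' = ρ := by omega
    have hss : s' = s := by omega
    subst hρρ; subst hss
    exact ⟨x, y, z, hxb hρ', hy1, hzρ, hw, h2s, hs2, rfl, hT, hdual⟩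
  · exfalso; subst b; subst c
    obtain ⟨h0, h1, -⟩ := hax (hasAxis_latt_hnf_G2 hϖ ρ' (by omega) (hxb hρ') hy1 hzρ)
    simp at h0 h1; omega
  · exfalso; subst b; subst c
    obtain ⟨h0, -, h2⟩ := hax (hasAxis_latt_hnf_G3 hϖ ρ' (by omega) (hxb (by omega)) hy1 hzρ)
    simp at h0 h2; omega
  · exfalso; subst b; subst c
    obtain ⟨h0, h1, -⟩ := hax (hasAxis_latt_hnf_H hϖ ρ' (hxb hρ') hzρ hw)
    simp at h0 h1; omega

/-- **THE STRATUM `(2ρ, 2ρ+s, 2ρ+s)` IS THE GLUED HNF FRAME SET** (B56-assembly head (1), LH4-p08 (g2) letters): for `ρ, s ≥ 1` and ANY `T ∈ GL₃(K)`,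
`stratum σ ϖ T (2ρ, 2ρ+s, 2ρ+s) = {latt (1 0 0; x ϖ^ρ 0; xζ+y″ ϖ^ρζ ϖ^{2ρ+s}) : |x| = |ζ| = 1, |y″| = |ϖ|^s, T-stable, dualisable}` (glued letters `ζ = z∕ϖ^ρ`,
`y″ = y − xζ`). [cite: Kottwitz1986BaseChangeUnits, §1 pp. 240–241] [cite: Serre1980Trees, Ch. II §1.1] -/
theorem stratum_G1_eq {σ : K →+* K} (hvσ : ∀ a, Valued.v (σ a) = Valued.v a)
    (hfix : ∀ x : K, σ x = x → x ≠ 0 → ∃ n : ℤ, Valued.v x = WithZero.exp (2 * n)) {ϖ : K} (hϖ : Valued.v ϖ = WithZero.exp (-1 : ℤ))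
    (T : GL (Fin 3) K) {ρ s : ℕ} (hρ : 1 ≤ ρ) (hs : 1 ≤ s) :
    stratum σ ϖ T ![2 * ρ, 2 * ρ + s, 2 * ρ + s] =
      {M | ∃ x ζ y'' : K, Valued.v x = 1 ∧ Valued.v ζ = 1 ∧ Valued.v y'' = Valued.v ϖ ^ s ∧
        M = latt (!![1, 0, 0; x, ϖ ^ ρ, 0; x * ζ + y'', ϖ ^ ρ * ζ, ϖ ^ (2 * ρ + s)] : Matrix (Fin 3) (Fin 3) K) ∧ mapGL T M = M ∧ IsDualisableLattice σ ϖ M} := by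
  have hϖ0 : ϖ ≠ 0 := (Valuation.ne_zero_iff Valued.v).1 (by rw [hϖ]; exact WithZero.exp_ne_zero)
  have hvϖ : 0 < Valued.v ϖ := (Valuation.pos_iff _).2 hϖ0
  have hϖ1 : Valued.v ϖ < 1 := by rw [hϖ, ← WithZero.exp_zero, WithZero.exp_lt_exp]; norm_num
  have hq1 : ∀ n : ℕ, Valued.v (ϖ ^ n) ≤ 1 := fun n => by rw [map_pow]; exact pow_le_one₀ zero_le hϖ1.le
  have hpρ : Valued.v (ϖ ^ ρ) ≠ 0 := by rw [map_pow]; exact pow_ne_zero _ hvϖ.ne'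
  ext M
  constructor
  · intro hM
    obtain ⟨x, y, z, hx1, hy1, hzρ, hw, -, -, rfl, hT, hdual⟩ := exists_hnf_of_mem_stratum_G1 hvσ hfix hϖ T hρ hs hM
    -- the glued letters
    set ζ : K := z * (ϖ ^ ρ)⁻¹ with hζdef
    set y'' : K := y - x * ζ with hy''def
    have hzeq : ϖ ^ ρ * ζ = z := by rw [hζdef]; field_simp
    have hyeq : x * ζ + y'' = y := by rw [hy''def]; ring
    have hζ : Valued.v ζ = 1 := by rw [hζdef, map_mul, map_inv₀, hzρ, mul_inv_cancel₀ hpρ]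
    have hy'' : Valued.v y'' = Valued.v ϖ ^ s := by
      have e : y'' = (y * ϖ ^ ρ - x * z) * (ϖ ^ ρ)⁻¹ := by rw [hy''def, hζdef]; field_simp
      rw [e, map_mul, map_inv₀, hw, map_pow, map_pow, pow_add, mul_comm (Valued.v ϖ ^ ρ), mul_assoc, mul_inv_cancel₀ (pow_ne_zero _ hvϖ.ne'), mul_one]
    refine ⟨x, ζ, y'', hx1, hζ, hy'', ?_, hT, hdual⟩
    rw [hyeq, hzeq]
  · rintro ⟨x, ζ, y'', hx1, hζ, hy'', rfl, hT, hdual⟩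
    have hz : Valued.v (ϖ ^ ρ * ζ) = Valued.v (ϖ ^ ρ) := by rw [map_mul, hζ, mul_one]
    have hxζ : Valued.v (x * ζ) = 1 := by rw [map_mul, hx1, hζ, mul_one]
    have hy1 : Valued.v (x * ζ + y'') = 1 := by
      rw [Valuation.map_add_eq_of_lt_left _ (by rw [hxζ, hy'']; exact pow_lt_one₀ zero_le hϖ1 (by omega)), hxζ]
    have hw : Valued.v ((x * ζ + y'') * ϖ ^ ρ - x * (ϖ ^ ρ * ζ)) = Valued.v (ϖ ^ (ρ + s)) := by
      rw [show (x * ζ + y'') * ϖ ^ ρ - x * (ϖ ^ ρ * ζ) = y'' * ϖ ^ ρ by ring, map_mul, hy'', map_pow, map_pow, pow_add, mul_comm]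
    -- the `GL₃` element
    have hdet : (!![1, 0, 0; x, ϖ ^ ρ, 0; x * ζ + y'', ϖ ^ ρ * ζ, ϖ ^ (2 * ρ + s)] : Matrix (Fin 3) (Fin 3) K).det ≠ 0 := by
      rw [Matrix.det_fin_three]; simp [hϖ0]
    refine (mem_stratum_iff σ ϖ T _ _).2 ⟨⟨⟨Matrix.GeneralLinearGroup.mkOfDetNeZero _ hdet, rfl⟩, hT, ?_⟩, hdual, hasAxis_latt_hnf_G1 hϖ ρ s hx1 hz hw⟩
    exact (normalised_latt_hnf_iff hx1.le hy1.le (by rw [hz]; exact hq1 ρ) (hq1 ρ) (hq1 _)).2 ⟨Or.inr hx1, Or.inr (Or.inl hy1)⟩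

/-- **A MEMBER OF THE STRATUM `(2ρ, 2ρ+s, 2ρ+s)` FORCES `s` EVEN** (B56-assembly head (2), LH4-p08 (g2) letters): for odd `s` the stratum is empty (★ B3: the axis
exponents of a dualisable lattice are even). [cite: Kottwitz1986BaseChangeUnits, §1 pp. 240–241] -/
theorem two_dvd_of_mem_stratum_G1 {σ : K →+* K} (hvσ : ∀ a, Valued.v (σ a) = Valued.v a)
    (hfix : ∀ x : K, σ x = x → x ≠ 0 → ∃ n : ℤ, Valued.v x = WithZero.exp (2 * n)) {ϖ : K} (hϖ : Valued.v ϖ = WithZero.exp (-1 : ℤ))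
    (T : GL (Fin 3) K) {ρ s : ℕ} (hρ : 1 ≤ ρ) (hs : 1 ≤ s) {M : Submodule 𝒪[K] (Fin 3 → K)}
    (hM : M ∈ stratum σ ϖ T ![2 * ρ, 2 * ρ + s, 2 * ρ + s]) : 2 ∣ s := by
  obtain ⟨-, -, -, -, -, -, -, h2s, -⟩ := exists_hnf_of_mem_stratum_G1 hvσ hfix hϖ T hρ hs hM
  exact h2s

/-- **THE STRATUM IS EMPTY FOR ODD `s`** (convenience form of head (2)). [cite: Kottwitz1986BaseChangeUnits, §1 pp. 240–241] -/
theorem stratum_G1_eq_empty_of_odd {σ : K →+* K} (hvσ : ∀ a, Valued.v (σ a) = Valued.v a)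
    (hfix : ∀ x : K, σ x = x → x ≠ 0 → ∃ n : ℤ, Valued.v x = WithZero.exp (2 * n)) {ϖ : K} (hϖ : Valued.v ϖ = WithZero.exp (-1 : ℤ))
    (T : GL (Fin 3) K) {ρ s : ℕ} (hρ : 1 ≤ ρ) (hs : ¬ 2 ∣ s) :
    stratum σ ϖ T ![2 * ρ, 2 * ρ + s, 2 * ρ + s] = ∅ := by
  refine Set.eq_empty_iff_forall_notMem.2 fun M hM => hs ?_
  exact two_dvd_of_mem_stratum_G1 hvσ hfix hϖ T hρ (by omega) hM

end Summit.HodgeConjecture.HodgeConjecture.Cruxes.H413.F0P3cDyRamDiagonalGluedStratum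

end
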